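import Mathlib
import Summits.MatrixMultiplication.MatrixMultiplication.Theorems.HyperoctahedralThreshold.Negative.HostedTPPSATTransfer
import Summits.MatrixMultiplication.MatrixMultiplication.Theorems.HyperoctahedralThreshold.Negative.Census4Data
import Summits.MatrixMultiplication.MatrixMultiplication.Theorems.HyperoctahedralThreshold.Negative.Census4Class0
import Summits.MatrixMultiplication.MatrixMultiplication.Theorems.HyperoctahedralThreshold.Negative.Census4Class1
import Summits.MatrixMultiplication.MatrixMultiplication.Theorems.HyperoctahedralThreshold.Negative.Census4Class2
import Summits.MatrixMultiplication.MatrixMultiplication.Theorems.HyperoctahedralThreshold.Negative.Census6Witness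

/-!
# `P_hyp(4) ≤ 32`: assembly of the 3 class certificates

Every triple `μ` of fixed-point-free involutions of `Fin 4` is, up to simultaneous conjugation and a
permutation of the three colours, one of the 3 class representatives `mus4 k` (classification table
`tbl4`, verified here by evaluation); the class certificates give `≤ 32` for each representative
(exact class values [8, 16, 32]); `hosted_bound_conj` / `hosted_bound_perm` transport the bound.
-/

namespace Summit.MatrixMultiplication.MatrixMultiplication.Theorems.HyperoctahedralThreshold.Negative

set_option linter.dupNamespace false

open Literature.Computability.Complexity Literature.Combinatorics.Additive

/-- Each class representative satisfies the bound `32`. [folklore] -/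
theorem class4_bound (k : Fin 3) : ∀ X : Fin 3 → Finset (Equiv.Perm (Fin 4)),
    (∀ i, ∀ σ ∈ X i, σ * mus4 k i = mus4 k i * σ) → TripleProductProperty (X 0) (X 1) (X 2) →
      (X 0).card * (X 1).card * (X 2).card ≤ 32 := by
  fin_cases k
  · intro X hX h; exact (D4c0_volume_le X hX h).trans (by norm_num)
  · intro X hX h; exact (D4c1_volume_le X hX h).trans (by norm_num)
  · intro X hX h; exact (D4c2_volume_le X hX h).trans (by norm_num)

/-- **`P_hyp(4) ≤ 32`**: every TPP triple inside the centralisers of three fixed-point-free involutions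
of `Fin 4` (perfect matchings; hosts `≅ S_2 ≀ S_2`) has volume at most `32`.
[cite: CohnUmans2003, Def. 2.1] -/
theorem hyp4_volume_le (μ : Fin 3 → Equiv.Perm (Fin 4)) (hμ : ∀ i, μ i * μ i = 1 ∧ ∀ x, μ i x ≠ x)
    (X : Fin 3 → Finset (Equiv.Perm (Fin 4))) (hX : ∀ i, ∀ σ ∈ X i, σ * μ i = μ i * σ)
    (htpp : TripleProductProperty (X 0) (X 1) (X 2)) :
    (X 0).card * (X 1).card * (X 2).card ≤ 32 := by
  obtain ⟨a, ha⟩ := exists_M4f_eq (μ 0) (hμ 0)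
  obtain ⟨b, hb⟩ := exists_M4f_eq (μ 1) (hμ 1)
  obtain ⟨c, hc⟩ := exists_M4f_eq (μ 2) (hμ 2)
  set ν : Fin 3 → Equiv.Perm (Fin 4) := ![M4f a, M4f b, M4f c] with hν
  have hμν : μ = ν := by
    funext i; fin_cases i
    · simpa [hν] using ha.symm
    · simpa [hν] using hb.symm
    · simpa [hν] using hc.symm
  subst hμν
  have hspec := tbl4f_spec a b c
  set k := (tbl4f a b c).1
  set g := (tbl4f a b c).2.1
  set π := (tbl4f a b c).2.2
  have hb1 := hosted_bound_conj (class4_bound k) g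
  have hb2 : ∀ Y : Fin 3 → Finset (Equiv.Perm (Fin 4)),
      (∀ i, ∀ σ ∈ Y i, σ * ν (π i) = ν (π i) * σ) → TripleProductProperty (Y 0) (Y 1) (Y 2) →
        (Y 0).card * (Y 1).card * (Y 2).card ≤ 32 := fun Y hY h =>
    hb1 Y (fun i σ hσ => by rw [← hspec i]; exact hY i σ hσ) h
  have hb3 := hosted_bound_perm (μ := fun i => ν (π i)) hb2 π.symm
  exact hb3 X (fun i σ hσ => by simpa using hX i σ hσ) htpp
/-- **Witness for `P_hyp(4) ≥ 32`**: an explicit TPP triple of sizes [2, 2, 8] inside the three Sylow-2 hosts of `S_4` (kit job j018287 selftest, brute force = SAT frontier). [folklore] -/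
theorem hyp4_witness :
    ∃ μ : Fin 3 → Equiv.Perm (Fin 4), (∀ i, μ i * μ i = 1 ∧ ∀ x, μ i x ≠ x) ∧
      ∃ X : Fin 3 → Finset (Equiv.Perm (Fin 4)), (∀ i, ∀ σ ∈ X i, σ * μ i = μ i * σ) ∧
        TripleProductProperty (X 0) (X 1) (X 2) ∧ (X 0).card * (X 1).card * (X 2).card = 32 := by
  refine ⟨![Equiv.swap (0 : Fin 4) 1 * Equiv.swap (2 : Fin 4) 3, Equiv.swap (0 : Fin 4) 2 * Equiv.swap (1 : Fin 4) 3, Equiv.swap (0 : Fin 4) 3 * Equiv.swap (1 : Fin 4) 2], by native_decide,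
    ![([1, Equiv.swap (0 : Fin 4) 2 * Equiv.swap (0 : Fin 4) 1 * Equiv.swap (0 : Fin 4) 3] : List (Equiv.Perm (Fin 4))).toFinset,
      ([1, Equiv.swap (0 : Fin 4) 1 * Equiv.swap (0 : Fin 4) 2 * Equiv.swap (0 : Fin 4) 3] : List (Equiv.Perm (Fin 4))).toFinset,
      ([1, Equiv.swap (1 : Fin 4) 2, Equiv.swap (0 : Fin 4) 1 * Equiv.swap (2 : Fin 4) 3, Equiv.swap (0 : Fin 4) 2 * Equiv.swap (0 : Fin 4) 3 * Equiv.swap (0 : Fin 4) 1, Equiv.swap (0 : Fin 4) 1 * Equiv.swap (0 : Fin 4) 3 * Equiv.swap (0 : Fin 4) 2, Equiv.swap (0 : Fin 4) 2 * Equiv.swap (1 : Fin 4) 3, Equiv.swap (0 : Fin 4) 3, Equiv.swap (0 : Fin 4) 3 * Equiv.swap (1 : Fin 4) 2] : List (Equiv.Perm (Fin 4))).toFinset],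
    by native_decide, ?_, by native_decide⟩
  exact tpp_of_quot6
    ([1, Equiv.swap (0 : Fin 4) 3 * Equiv.swap (0 : Fin 4) 1 * Equiv.swap (0 : Fin 4) 2, Equiv.swap (0 : Fin 4) 2 * Equiv.swap (0 : Fin 4) 1 * Equiv.swap (0 : Fin 4) 3] : List (Equiv.Perm (Fin 4))).toFinset
    ([1, Equiv.swap (0 : Fin 4) 3 * Equiv.swap (0 : Fin 4) 2 * Equiv.swap (0 : Fin 4) 1, Equiv.swap (0 : Fin 4) 1 * Equiv.swap (0 : Fin 4) 2 * Equiv.swap (0 : Fin 4) 3] : List (Equiv.Perm (Fin 4))).toFinset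
    ([1, Equiv.swap (1 : Fin 4) 2, Equiv.swap (0 : Fin 4) 1 * Equiv.swap (2 : Fin 4) 3, Equiv.swap (0 : Fin 4) 2 * Equiv.swap (0 : Fin 4) 3 * Equiv.swap (0 : Fin 4) 1, Equiv.swap (0 : Fin 4) 1 * Equiv.swap (0 : Fin 4) 3 * Equiv.swap (0 : Fin 4) 2, Equiv.swap (0 : Fin 4) 2 * Equiv.swap (1 : Fin 4) 3, Equiv.swap (0 : Fin 4) 3, Equiv.swap (0 : Fin 4) 3 * Equiv.swap (1 : Fin 4) 2] : List (Equiv.Perm (Fin 4))).toFinset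
    (by native_decide) (by native_decide) (by native_decide) (by native_decide)

/-- **`P_hyp(4) = 32`** (certified census, n = 4): the maximum of `|X 0||X 1||X 2|` over fixed-point-free
involution triples `μ` of `Fin 4` and TPP triples `X i ⊆ C(μ i)` is exactly `32` (`= (4!)^{3/2}·0.272`;
classes 8 / 16 / 32).  Witness by evaluation, upper bound by three LRAT certificates. [folklore] -/
theorem hyp4_max :
    (∃ μ : Fin 3 → Equiv.Perm (Fin 4), (∀ i, μ i * μ i = 1 ∧ ∀ x, μ i x ≠ x) ∧
      ∃ X : Fin 3 → Finset (Equiv.Perm (Fin 4)), (∀ i, ∀ σ ∈ X i, σ * μ i = μ i * σ) ∧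
        TripleProductProperty (X 0) (X 1) (X 2) ∧ (X 0).card * (X 1).card * (X 2).card = 32) ∧
    (∀ μ : Fin 3 → Equiv.Perm (Fin 4), (∀ i, μ i * μ i = 1 ∧ ∀ x, μ i x ≠ x) →
      ∀ X : Fin 3 → Finset (Equiv.Perm (Fin 4)), (∀ i, ∀ σ ∈ X i, σ * μ i = μ i * σ) →
        TripleProductProperty (X 0) (X 1) (X 2) → (X 0).card * (X 1).card * (X 2).card ≤ 32) :=
  ⟨hyp4_witness, hyp4_volume_le⟩

end Summit.MatrixMultiplication.MatrixMultiplication.Theorems.HyperoctahedralThreshold.Negative
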